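import Literature.IUT.HodgeTheaters.InitialThetaDataTorsionCuspModelKLevel
import Literature.IUT.HodgeTheaters.InitialThetaDataTorsionMonodromyUnramified
import HarnessLib

/-!
# [IUTchI] Def 3.1 (b)(c)(d) / Def 6.1 (v) / §1 p.37: the assembled `ThetaGeometry` of the group-ring two-step model, the
# re-geometrised initial Θ-datum `regeom₃`, and its (unramified) `l`-TORSION MONODROMY TERM
# (NV-L5 row «JOINT-NV-CG (l cusps)», part B3; definitions)

S. Mochizuki, *Inter-universal Teichmüller theory I*, kurims manuscript (May 2020), §3 Definition 3.1 (c) p. 62 «`K ⊆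
F̄` … the finite Galois extension of `F` determined by the kernel of this homomorphism», (d) p. 62 «`C̲_K` … of type
`(1, l-tors)±` … with `K`-core `C_K := C_F ×_F K` … `X̲_K` of type `(1, l-tors)`», §6 Definition 6.1 (v) p. 158 «from
the Galois action on `Δ_X^{ab} ⊗ 𝔽_l` … the rank one quotient of `Δ_X^{ab} ⊗ 𝔽_l` that gives rise to the covering
`X̲_K → X_K`», §1 p. 37 «`0 → I_{ε′} × I_{ε″} → Δ_ε → Δ_E ⊗ (ℤ/lℤ) → 0`» ([IUTchI] Def 3.1 (c)(d) p.62, Def 6.1 (v)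
p.158, §1 p.37) [claim: Mochizuki2012, status: disputed] (D-0012 claim key; series status DISPUTED — a MODEL of the
cell's `π₁`-interface structures; nothing of the series is asserted; no side taken on [IUTchIII] Cor. 3.12).

## WHAT (continuing `…TorsionCuspModel.lean` / `…TorsionCuspModelKLevel.lean`; design memo
## HOME/staging/L5/L5-t8/g7/STEP0-jointNV-CG.md)

* `embK₃ : G_K × DihU ↪ Π_{C_F} = Del ⋊ (G_F × {±1})`, `(σ, ⟨d, u⟩) ↦ ⟨d, (σ, u)⟩` — a HOMOMORPHISM because `G_K` acts
  trivially on `Del` (`outer_eq_one_of_fixesTorsion`, Def 3.1 (c)) — image `Π_{C_F} ×_{G_F} G_K`,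
  `embK₃(Π_{X_K}) = Π_{X_F} ∩ Π_{C_K}`;
* `geometryOf₃` — every field of abc-iut-L5-t2's `ThetaGeometry (F̄ ≃ₐ[F] F̄) G_K l` for the model (indices from part B2);
* `InitialThetaData.coGen D₀` — a torsion point OUTSIDE the line `ℤ·g` (`#E_F[l](F̄) = l² > l`); `InitialThetaData.regeom₃
  D₀ := { D₀ with geom := geometryOf₃ … }` — ANY initial Θ-datum re-geometrised by the model, every hypothesis discharged
  from `D₀` as in the gen-6 `regeom`;
* **`InitialThetaData.torsionMonodromyRegeom₃ D₀ : D₀.regeom₃.TorsionMonodromy`** (`τ := pt ∘ tc`, the cocycle law IS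
  the semidirect multiplication on `Π_{X_F}`; `gen := g`; `Π_{X̲_K} = G_K × proj⁻¹(ℤ·g ⋊ 1)` cut out by `τ ∈ ℤ·gen`) and
  **`InitialThetaData.unramifiedTorsionMonodromyRegeom₃ D₀ : D₀.regeom₃.UnramifiedTorsionMonodromy`** — `τ` KILLS EVERY
  CUSP INERTIA GROUP (the inertia vectors live in `U = ker(τ)`; here with NONTRIVIAL inertia, unlike the gen-6 `regeom`).
The cusp Galois action `CuspGalois` (data + 10 laws), `ModLCuspLaws` and the joint-∃ statements are parts B4–B6.

HONEST LABEL «[model; `E[l]`-twisted finite shadow `U ⋊ E[l]`; `l` cusps; CG INHABITED (part B4)]»: only the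
`Π_{C_F}`-module `E_F[l](F̄)` with its Galois action and sign is the curve's; `Δ_X`, the cusps' inertia module and the
decomposition groups are synthetic.  Instantiated ≠ endorsed; typed ≠ proved; no side taken on [IUTchIII] Cor. 3.12.
-/

noncomputable section

namespace Literature.IUT.HodgeTheaters

universe u

namespace TorsionCuspModel

open Literature.AnabelianGeometry.AbsoluteAnabelian Topology TorsionMonodromyModel
open Literature.AnabelianGeometry.EtaleTheta.SettingModel
open scoped WeierstrassCurve.Affine Classical

/-! ## The embedding `Π_{C_K} ↪ Π_{C_F}` and the assembled `ThetaGeometry` -/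

section Geometry

variable {F : Type u} (K : Type u) {Fbar : Type u} [Field F] [Field K] [Field Fbar] [Algebra F Fbar]
  [Algebra K Fbar] (E : WeierstrassCurve F) (l : ℕ)

variable {K E l}

/-- `outer (σ, u) = outer (1, u)` for `σ` fixing the `l`-torsion. [cite: Mochizuki2012, IUTchI Def 3.1 (c) p.62] -/
theorem outer_of_fixesTorsion {σ : Fbar ≃ₐ[F] Fbar} (h : FixesTorsion E l σ) (u : ℤˣ) :
    outer F E Fbar l (σ, u) = outerK F E Fbar l u := by
  have : ((σ, u) : GalPM F Fbar) = (σ, 1) * (1, u) := by rw [Prod.mk_mul_mk, mul_one, one_mul]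
  rw [this, map_mul, outer_eq_one_of_fixesTorsion h, one_mul, outerK_apply]

/-- **`embK₃ : Π_{C_K} = G_K × DihU ↪ Π_{C_F} = Del ⋊ (G_F × {±1})`**, `(σ, ⟨d, u⟩) ↦ ⟨d, (σ, u)⟩` — a HOMOMORPHISM because
`G_K` acts trivially on `Del` (`hK`, Def 3.1 (c)). [cite: Mochizuki2012, IUTchI Def 3.1 (d) p.62] -/
def embK₃ (hK : ∀ σ ∈ galoisSubgroupOf F K Fbar, FixesTorsion E l σ) :
    (galoisSubgroupOf F K Fbar × DihU F E Fbar l) →* PiC F E Fbar l where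
  toFun x := ⟨x.2.left, ((x.1 : Fbar ≃ₐ[F] Fbar), x.2.right)⟩
  map_one' := rfl
  map_mul' x y := by
    refine SemidirectProduct.ext ?_ rfl
    show x.2.left * outerK F E Fbar l x.2.right y.2.left =
      x.2.left * outer F E Fbar l ((x.1 : Fbar ≃ₐ[F] Fbar), x.2.right) y.2.left
    rw [outer_of_fixesTorsion (hK _ x.1.2)]

/-- [cite: Mochizuki2012, IUTchI Def 3.1 (d) p.62] -/
@[simp] theorem embK₃_left (hK : ∀ σ ∈ galoisSubgroupOf F K Fbar, FixesTorsion E l σ)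
    (x : galoisSubgroupOf F K Fbar × DihU F E Fbar l) : (embK₃ hK x).left = x.2.left := rfl

/-- [cite: Mochizuki2012, IUTchI Def 3.1 (d) p.62] -/
@[simp] theorem embK₃_right (hK : ∀ σ ∈ galoisSubgroupOf F K Fbar, FixesTorsion E l σ)
    (x : galoisSubgroupOf F K Fbar × DihU F E Fbar l) :
    (embK₃ hK x).right = ((x.1 : Fbar ≃ₐ[F] Fbar), x.2.right) := rfl

/-- `embK₃` is injective. [cite: Mochizuki2012, IUTchI Def 3.1 (d) p.62] -/
theorem embK₃_injective (hK : ∀ σ ∈ galoisSubgroupOf F K Fbar, FixesTorsion E l σ) :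
    Function.Injective (embK₃ hK) := by
  rintro ⟨a, b⟩ ⟨a', b'⟩ h
  have h1 := congrArg SemidirectProduct.left h
  have h2 := congrArg SemidirectProduct.right h
  simp only [embK₃_left, embK₃_right, Prod.mk.injEq] at h1 h2
  exact Prod.ext (Subtype.ext h2.1) (SemidirectProduct.ext h1 h2.2)

/-- `x ∈ Im(embK₃) ↔ aug x ∈ G_K`. [cite: Mochizuki2012, IUTchI Def 3.1 (d) p.62] -/
theorem mem_range_embK₃_iff (hK : ∀ σ ∈ galoisSubgroupOf F K Fbar, FixesTorsion E l σ) (x : PiC F E Fbar l) :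
    x ∈ (embK₃ hK).range ↔ x.right.1 ∈ galoisSubgroupOf F K Fbar := by
  constructor
  · rintro ⟨y, rfl⟩
    exact y.1.2
  · intro hx
    exact ⟨(⟨x.right.1, hx⟩, ⟨x.left, x.right.2⟩), SemidirectProduct.ext rfl (Prod.ext rfl rfl)⟩

/-- `embK₃` is continuous. [cite: Mochizuki2012, IUTchI Def 3.1 (d) p.62] -/
theorem embK₃_continuous (hK : ∀ σ ∈ galoisSubgroupOf F K Fbar, FixesTorsion E l σ) : Continuous (embK₃ hK) := by
  refine (Semidirect.continuous_iff_left_right (PiC.isInducing F E Fbar l)).2 ⟨?_, ?_⟩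
  · exact (continuous_of_discreteTopology :
      Continuous (SemidirectProduct.left : DihU F E Fbar l → Del E Fbar l)).comp continuous_snd
  · exact (continuous_subtype_val.comp continuous_fst).prodMk
      ((continuous_of_discreteTopology : Continuous (SemidirectProduct.right : DihU F E Fbar l → ℤˣ)).comp
        continuous_snd)

variable (K E l) in
/-- **The group-ring two-step model of the `π₁`-interface of [IUTchI] Def 3.1 (b)(d)(f)** for `G_F = Gal(F̄/F) ⊇ G_K`
with `G_K` acting trivially on `E_F[l](F̄)` (`hK`), `l ≥ 5` prime, `#E_F[l](F̄) = l²`, a line generator `g ≠ 1` and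
`a ∉ ℤ·g`: `Π_{C_F} := (𝔽_l[E_F[l]] ⋊ E_F[l]) ⋊ (G_F × {±1})`, `Π_{C_K} = G_K × DihU`, the §1 datum `pedOf₃` with its
`l` cusps.  Every field of `ThetaGeometry` holds. [cite: Mochizuki2012, IUTchI Def 3.1 p.61–63] -/
def geometryOf₃ [Algebra F K] [IsScalarTower F K Fbar] [IsGalois F Fbar] [E.IsElliptic]
    (hK : ∀ σ ∈ galoisSubgroupOf F K Fbar, FixesTorsion E l σ) (hl : l.Prime) (h5 : 5 ≤ l)
    (hcard : Nat.card (Tors E Fbar l) = l ^ 2) (g : Tors E Fbar l) (hg : g ≠ 1) (a : Tors E Fbar l)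
    (ha : a ∉ Subgroup.zpowers g) : ThetaGeometry (Fbar ≃ₐ[F] Fbar) (galoisSubgroupOf F K Fbar) l :=
  haveI : NeZero l := ⟨hl.ne_zero⟩
  letI : CompactSpace (galoisSubgroupOf F K Fbar) :=
    isCompact_iff_compactSpace.mp (ThetaGeometryModel.isClosed_galoisSubgroupOf F K Fbar).isCompact
  { extF := ext F E Fbar l
    galIso := MulEquiv.refl _
    galIso_continuous := ⟨continuous_id, continuous_id⟩
    PiX := PiX F E Fbar l
    PiX_isOpen := PiX_isOpen F E Fbar l
    PiX_normal := PiX_normal F E Fbar l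
    PiX_index := PiX_index F E Fbar l
    aug_PiX := by
      rw [eq_top_iff]
      intro σ _
      exact ⟨SemidirectProduct.inr (σ, 1), inr_mem_PiX F E Fbar l σ, rfl⟩
    pe := pedOf₃ F E Fbar l (galoisSubgroupOf F K Fbar) g Quotient.out (a ^ ((l + 1) / 2)) a hl ha h5
      (coprime_six_of_prime l hl h5)
    pe_l := rfl
    embK := embK₃ hK
    embK_continuous := embK₃_continuous hK
    embK_injective := embK₃_injective hK
    embK_range := by
      ext x
      exact mem_range_embK₃_iff hK x
    galKIso := MulEquiv.refl _
    aug_compat := fun _ => rfl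
    embK_PiX := by
      ext x
      constructor
      · rintro ⟨y, hy, rfl⟩
        exact ⟨(mem_PiX_iff F E Fbar l _).mpr ((mem_dX_iff _).mp (mem_liftU.mp hy)), y, rfl⟩
      · rintro ⟨hx, y, rfl⟩
        exact ⟨y, mem_liftU.mpr ((mem_dX_iff _).mpr ((mem_PiX_iff F E Fbar l _).mp hx)), rfl⟩
    PiXbar_relIndex := by
      show (liftU _ (dX F E Fbar l) ⊓ liftU _ (dC F E g)).relIndex (liftU _ (dX F E Fbar l)) = l
      rw [← liftU_inf, liftU_relIndex]
      exact dXbar_relIndex_dX hl hcard hg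
    aug_PiXbar := by
      show Function.Surjective ((MonoidHom.fst _ _).comp (liftU _ (dX F E Fbar l) ⊓ liftU _ (dC F E g)).subtype)
      rw [← liftU_inf]
      exact fst_liftU_surjective _ _
    PiXbar_relIndex_PiCbar := by
      show (liftU _ (dX F E Fbar l) ⊓ liftU _ (dC F E g)).relIndex (liftU _ (dC F E g)) = 2
      rw [← liftU_inf, liftU_relIndex]
      exact dXbar_relIndex_dC hl hcard hg
    not_PiCbar_le_PiX := by
      intro h
      apply not_dC_le_dX (F := F) (E := E) (Fbar := Fbar) (l := l) g
      intro d hd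
      exact h (show ((1 : galoisSubgroupOf F K Fbar), d) ∈ liftU _ (dC F E g) from hd) }

/-- The cocycle identity of the model on `Π_{X_F}` (`u = 1`), on points. [cite: Mochizuki2012, IUTchI Def 6.1 (v) p.158] -/
theorem pt_tc_mul_of_snd_eq_one {g : PiC F E Fbar l} (hg : g.right.2 = 1) (h : PiC F E Fbar l) :
    Tors.pt (tc (g * h)) = Tors.pt (tc g) + galoisAct E g.right.1 (Tors.pt (tc h)) := by
  rw [pt_tc_mul, hg, Units.val_one, one_smul]

end Geometry

end TorsionCuspModel

/-! ## Re-geometrised initial Θ-data and the (unramified) `l`-torsion monodromy TERM -/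

namespace InitialThetaData

open TorsionMonodromyModel TorsionCuspModel
open scoped WeierstrassCurve.Affine Classical

variable {F K Fbar : Type u} [Field F] [NumberField F] [Field K] [NumberField K] [Algebra F K] [Field Fbar]
  [Algebra F Fbar] [Algebra K Fbar] {E : WeierstrassCurve F} [E.IsElliptic] {l : ℕ} {Pb : BadPlacePredicates K}

/-- There is an `l`-torsion point OUTSIDE the line `ℤ·g` (`#E_F[l](F̄) = l² > l = #ℤ·g`).
[cite: Mochizuki2012, IUTchI Def 3.1 (c) p.62] -/
theorem exists_not_mem_zpowers_lineGen (D₀ : InitialThetaData F K Fbar E l Pb) :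
    ∃ a : Tors E Fbar l, a ∉ Subgroup.zpowers D₀.lineGen := by
  haveI := D₀.isAlgClosure
  haveI : NeZero l := ⟨D₀.l_prime.ne_zero⟩
  by_contra h
  push Not at h
  have htop : Subgroup.zpowers D₀.lineGen = ⊤ := eq_top_iff.mpr fun a _ => h a
  have hc := Tors.card_zpowers D₀.l_prime D₀.lineGen_ne_one
  rw [htop, Subgroup.card_top, D₀.card_tors_eq] at hc
  have h5 := D₀.five_le_l
  have : l ^ 2 = l * l := sq l
  nlinarith

/-- A chosen torsion point outside the line `ℤ·g` (the «`a`» of the model: `τ(a) ∉ 𝔽_l·gen`).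
[cite: Mochizuki2012, IUTchI Def 3.1 (c) p.62] -/
def coGen (D₀ : InitialThetaData F K Fbar E l Pb) : Tors E Fbar l := D₀.exists_not_mem_zpowers_lineGen.choose

/-- `coGen ∉ ℤ·g`. [cite: Mochizuki2012, IUTchI Def 3.1 (c) p.62] -/
theorem coGen_not_mem (D₀ : InitialThetaData F K Fbar E l Pb) : D₀.coGen ∉ Subgroup.zpowers D₀.lineGen :=
  D₀.exists_not_mem_zpowers_lineGen.choose_spec

/-- **The re-geometrised initial Θ-datum (group-ring two-step model)**: `D₀` with its `π₁`-interface field `geom`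
REPLACED by `geometryOf₃` (all arithmetic fields (a)–(c), (e) of Def 3.1 kept; hypotheses discharged from `D₀`).
[cite: Mochizuki2012, IUTchI Def 3.1 p.61–63] -/
def regeom₃ (D₀ : InitialThetaData F K Fbar E l Pb) : InitialThetaData F K Fbar E l Pb :=
  haveI := D₀.isAlgClosure
  haveI := D₀.isScalarTower
  { D₀ with
    geom := geometryOf₃ K E l D₀.fixesTorsion_of_mem_galoisSubgroupOf D₀.l_prime D₀.five_le_l D₀.card_tors_eq
      D₀.lineGen D₀.lineGen_ne_one D₀.coGen D₀.coGen_not_mem }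

/-- **The `l`-TORSION MONODROMY TERM of `regeom₃`** ([IUTchI] Def 3.1 (c)(d) / [EtTh] Def 2.1 / Def 6.1 (v); this
lineage's interface datum `TorsionMonodromy`): `τ := pt ∘ tc` (the `E_F[l]`-coordinate; the cocycle law IS the
semidirect multiplication on `Π_{X_F}`), `gen := g`, and `Π_{X̲_K} = G_K × proj⁻¹(ℤ·g ⋊ 1)` is cut out by `τ ∈ ℤ·gen`.
[cite: Mochizuki2012, IUTchI Def 6.1 (v) p.158] -/
def torsionMonodromyRegeom₃ (D₀ : InitialThetaData F K Fbar E l Pb) : D₀.regeom₃.TorsionMonodromy :=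
  haveI := D₀.isAlgClosure
  haveI := D₀.isScalarTower
  haveI : NeZero l := ⟨D₀.l_prime.ne_zero⟩
  { tau := fun x => Tors.pt (tc (x : TorsionCuspModel.PiC F E Fbar l))
    tau_torsion := fun g _ => Tors.torsion_pt _
    tau_mul := fun g hg h _ =>
      pt_tc_mul_of_snd_eq_one ((TorsionCuspModel.mem_PiX_iff F E Fbar l _).mp hg) h
    tau_surjOn := by
      intro P hP
      refine ⟨(SemidirectProduct.inl (SemidirectProduct.inr (Tors.ofPt P hP)) : TorsionCuspModel.PiC F E Fbar l),
        ⟨TorsionCuspModel.inl_mem_PiX F E Fbar l _, ?_⟩, ?_⟩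
      · exact (TorsionCuspModel.mem_geom_ext_iff F E Fbar l _).mpr rfl
      · show Tors.pt (tc (SemidirectProduct.inl (SemidirectProduct.inr (Tors.ofPt P hP)) :
          TorsionCuspModel.PiC F E Fbar l)) = P
        rw [tc_inl, SemidirectProduct.right_inr, Tors.pt_ofPt]
    gen := Tors.pt D₀.lineGen
    gen_torsion := Tors.torsion_pt _
    gen_ne_zero := by
      rw [Ne, Tors.pt_eq_zero_iff]
      exact D₀.lineGen_ne_one
    mem_PiXund_iff := by
      haveI : CompactSpace (galoisSubgroupOf F K Fbar) :=
        isCompact_iff_compactSpace.mp (ThetaGeometryModel.isClosed_galoisSubgroupOf F K Fbar).isCompact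
      intro k hk
      obtain ⟨hkX, y, rfl⟩ := hk
      have hy2 : y.2.right = 1 := (TorsionCuspModel.mem_PiX_iff F E Fbar l _).mp hkX
      change embK₃ D₀.fixesTorsion_of_mem_galoisSubgroupOf y ∈
          (pedOf₃ F E Fbar l (galoisSubgroupOf F K Fbar) D₀.lineGen Quotient.out (D₀.coGen ^ ((l + 1) / 2)) D₀.coGen
            D₀.l_prime D₀.coGen_not_mem D₀.five_le_l
            (coprime_six_of_prime l D₀.l_prime D₀.five_le_l)).PiXbar.map
            (embK₃ D₀.fixesTorsion_of_mem_galoisSubgroupOf) ↔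
        ∃ a : ℤ, Tors.pt (tc (embK₃ D₀.fixesTorsion_of_mem_galoisSubgroupOf y)) = a • Tors.pt D₀.lineGen
      constructor
      · rintro ⟨z, hz, hzy⟩
        obtain rfl : z = y := embK₃_injective _ hzy
        obtain ⟨c, hc⟩ := Subgroup.mem_zpowers_iff.mp ((mem_dC_iff _ _).mp (mem_liftU.mp hz.2))
        exact ⟨c, by rw [← Tors.pt_zpow, hc]; rfl⟩
      · rintro ⟨c, hc⟩
        refine ⟨y, ⟨mem_liftU.mpr ((mem_dX_iff _).mpr hy2), mem_liftU.mpr ((mem_dC_iff _ _).mpr ?_)⟩, rfl⟩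
        exact Subgroup.mem_zpowers_iff.mpr ⟨c, Tors.pt_injective (by rw [Tors.pt_zpow, ← hc]; rfl)⟩ }

omit [NumberField F] [E.IsElliptic] in
/-- Powers of an inertia generator have trivial torsion coordinate. [cite: Mochizuki2012, IUTchI §1 p.37] -/
theorem left_right_eq_one_of_mem_zpowers_igen {g : Tors E Fbar l}
    (s : Tors E Fbar l ⧸ Subgroup.zpowers g → Tors E Fbar l) (h : Tors E Fbar l)
    (q : Tors E Fbar l ⧸ Subgroup.zpowers g) {d : TorsionCuspModel.DihU F E Fbar l}
    (hd : d ∈ Subgroup.zpowers (igen (F := F) s h q)) : d.left.right = 1 := by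
  obtain ⟨n, rfl⟩ := Subgroup.mem_zpowers_iff.mp hd
  rw [igen, ← map_zpow, ← map_zpow, SemidirectProduct.left_inl, SemidirectProduct.right_inl]

/-- **The UNRAMIFIED `l`-torsion monodromy term of `regeom₃`** — `τ` kills EVERY cusp inertia group (the inertia
vectors live in `U = ker(pr_T)`; here the inertia groups are NONTRIVIAL, unlike the gen-6 `regeom`): an inhabitant of this
lineage's v-next datum `UnramifiedTorsionMonodromy` (p448163). [cite: Mochizuki2012, IUTchI §1 p.37] -/
def unramifiedTorsionMonodromyRegeom₃ (D₀ : InitialThetaData F K Fbar E l Pb) :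
    D₀.regeom₃.UnramifiedTorsionMonodromy :=
  ⟨D₀.torsionMonodromyRegeom₃, fun x k hk => by
    have h1 : (k : galoisSubgroupOf F K Fbar × TorsionCuspModel.DihU F E Fbar l).2.left.right = 1 :=
      left_right_eq_one_of_mem_zpowers_igen _ _ x (mem_liftU.mp hk.1)
    show Tors.pt (tc (embK₃ D₀.fixesTorsion_of_mem_galoisSubgroupOf k)) = 0
    rw [tc, embK₃_left, h1, Tors.pt_one]⟩

/-- **NON-VACUITY**: the re-geometrised datum CARRIES an `UnramifiedTorsionMonodromy` (hence a `TorsionMonodromy` with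
`hI`) — now at a datum with `l` cusps and nontrivial inertia. [cite: Mochizuki2012, IUTchI Def 6.1 (v) p.158] -/
theorem nonempty_unramifiedTorsionMonodromy_regeom₃ (D₀ : InitialThetaData F K Fbar E l Pb) :
    Nonempty D₀.regeom₃.UnramifiedTorsionMonodromy :=
  ⟨D₀.unramifiedTorsionMonodromyRegeom₃⟩

/-- The re-geometrised datum keeps `V^bad_mod`. [cite: Mochizuki2012, IUTchI Def 3.1 (b) p.61] -/
theorem regeom₃_VbadMod (D₀ : InitialThetaData F K Fbar E l Pb) : D₀.regeom₃.VbadMod = D₀.VbadMod := rfl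

/-- The re-geometrised datum keeps `V̲`. [cite: Mochizuki2012, IUTchI Def 3.1 (e) p.62] -/
theorem regeom₃_V (D₀ : InitialThetaData F K Fbar E l Pb) : D₀.regeom₃.V = D₀.V := rfl

end InitialThetaData

end Literature.IUT.HodgeTheaters

end
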